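import Literature.Topology.FourManifolds.ConnectedSum
import Literature.Topology.FourManifolds.ConnectedSumTransportProofs
import HarnessLib

/-!
# Connected sums of spheres: `Sⁿ # Sⁿ ≅ Sⁿ` and iterated connected sums of copies of `Sⁿ`

Topic `Literature/Topology/FourManifolds` (trunk T-4MAN), companion to
`Literature.Topology.FourManifolds.ConnectedSum` (`Literature.Topology.FourManifolds.IsConnectedSum`, the relational connected
sum of Kervaire–Milnor). Written for the decomposition of the named fact
`Literature.Geometry.Riemannian.hamilton_pic_sphere_four` (`Literature/Geometry/Riemannian/PICSphereFacts.lean`,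
Hamilton 1997, Cor. 1.2(a): a compact simply connected 4-manifold with positive isotropic
curvature is diffeomorphic to `S⁴`) along its printed proof: Hamilton's Main Theorem 1.1
(Ricci flow with surgery) yields the manifold as *a connected sum of copies of `S⁴`*, and the
purely differential-topological step "a connected sum of spheres is a sphere" turns this into
Cor. 1.2(a). This file provides that topological step:

* `Literature.IsConnectedSumOfSpheres n P` — the smooth `n`-manifold `P` (a charted space on `ℝⁿ`) is
  *a connected sum of finitely many copies of `Sⁿ`*: the inductively defined smallest class of
  charted spaces containing every `P` diffeomorphic to the round sphere `𝕊ⁿ` and containing `P`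
  whenever `P` is a connected sum `M # N` (`Literature.Topology.FourManifolds.IsConnectedSum`, along arbitrary smooth discs)
  of two Hausdorff `C^∞` manifolds `M`, `N` of the class. Any bracketing of an iterated sum is
  allowed (no associativity is presupposed). Real definition, with the unfolding lemma
  `Literature.Topology.FourManifolds.isConnectedSumOfSpheres_iff`, `Literature.Topology.FourManifolds.IsConnectedSumOfSpheres.sphere_self` and invariance
  under diffeomorphism `Literature.Topology.FourManifolds.IsConnectedSumOfSpheres.of_diffeomorph` (proved, from the transport
  of open gluings `Literature.Topology.FourManifolds.IsOpenGluing.diffeomorph_comp` of `ConnectedSumTransportProofs.lean`, via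
  `Literature.Topology.FourManifolds.IsConnectedSum.of_diffeomorph`).
* `Literature.connectedSum_sphere_sphere n` — NAMED FACT (**Kervaire–Milnor 1963, Lemma 2.1**), one
  `Prop` per dimension `n`: a connected sum of two manifolds diffeomorphic to `Sⁿ` (`0 < n`) is
  diffeomorphic to `Sⁿ`.
* `Literature.Topology.FourManifolds.IsConnectedSumOfSpheres.nonempty_diffeomorph_sphere` — PROVED from that fact by
  induction: every connected sum of finitely many copies of `Sⁿ` (`0 < n`) is diffeomorphic to
  `Sⁿ`. Only the instance `n = 4` is consumed by the PIC decomposition.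

## The named fact and its source

Kervaire–Milnor, *Groups of homotopy spheres I*, Ann. of Math. 77 (1963), §2, p. 505, define
`M₁ # M₂` for connected oriented `n`-manifolds by choosing disc embeddings `i₁ : Dⁿ → M₁`
(orientation preserving), `i₂ : Dⁿ → M₂` (orientation reversing) and identifying `i₁ (t u)` with
`i₂ ((1 - t) u)`, `0 < t < 1` — literally the relation `Literature.Topology.FourManifolds.connectedSumRel` — and prove
**Lemma 2.1**: "The connected sum operation is well defined, associative, and commutative up to
orientation preserving diffeomorphism. The sphere `Sⁿ` serves as identity element." (proof:
"the lemma of Palais [20] and Cerf [5] which asserts that any two orientation preserving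
imbeddings `i, i' : Dⁿ → M` are related by the equation `i' = f ∘ i`, for some diffeomorphism
`f : M → M`"; Palais, *Extending diffeomorphisms*, Proc. AMS 11 (1960); Kosinski,
*Differential Manifolds* (1993), VI.1). `Literature.connectedSum_sphere_sphere n` is the case
`M₁ ≅ M₂ ≅ Sⁿ` of "well defined" plus "`Sⁿ` serves as identity": `Sⁿ # Sⁿ ≅ Sⁿ` for *every*
choice of discs. Two remarks make the match with the tree's unoriented, relational
`Literature.Topology.FourManifolds.IsConnectedSum` exact: (i) `Sⁿ` admits an orientation-reversing diffeomorphism (a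
reflection), so after transporting the two discs to `Sⁿ` along the given diffeomorphisms one may
compose with reflections to make the first disc orientation preserving and the second reversing,
which puts an arbitrary pair of discs in Kervaire–Milnor's oriented situation; (ii) the tree's
`IsConnectedSum M N P` only asks `P` to be *an* open gluing of the punctured pieces along the
relation, and any two such gluings are diffeomorphic by the PROVED uniqueness of open gluings
`Literature.Topology.FourManifolds.IsOpenGluing.nonempty_diffeomorph` (`GluingUniqueness.lean`; Kosinski VI.1). The hypothesis
`0 < n` is Kervaire–Milnor's "connected `n`-manifolds" (`S⁰` is not connected). Stated as a
named fact, one `Prop` per dimension, and DISCHARGED for every `n`: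
`Literature.Topology.FourManifolds.connectedSum_sphere_sphere_holds` in
`Literature/Topology/FourManifolds/ConnectedSumSphereIdentity.lean`, as a corollary of
`X # Sⁿ ≅ X` (`Literature.Topology.FourManifolds.nonempty_diffeomorph_of_isConnectedSum_sphere_holds`) — from Palais' disc
theorem on the sphere (`Literature.Topology.FourManifolds.exists_diffeomorph_apply_stereographic_symm_eq`,
`PalaisDiscSphere.lean`, itself from `Literature.Topology.FourManifolds.hasComplementBall_of_isSmoothEmbedding` of
`PalaisBallComplement.lean`), the standard model of `X` as an open gluing of `X ∖ {pt}` and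
`Sⁿ ∖ {pt}`, and the uniqueness of open gluings (`Literature.Topology.FourManifolds.IsOpenGluing.nonempty_diffeomorph`). (The
model of `Sⁿ` itself as an open gluing of two punctured spheres is
`Literature.Topology.FourManifolds.SphereGluing.isOpenGluing_sphere`, `SphereSelfGluing.lean`.)

## Design

* `IsConnectedSumOfSpheres` is an inductive predicate on `(P : Type) [TopologicalSpace P]
  [ChartedSpace ℝⁿ P]` (all manifolds in `Type`, as for `Literature.Topology.FourManifolds.IsStabilization` and
  `Literature.Topology.FourManifolds.HomotopySphere`). The constructor `connectedSum` records the summands `M`, `N` with the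
  instance hypotheses under which `Literature.Topology.FourManifolds.IsConnectedSum` and the smoothness of the discs are
  meaningful (`T2Space`, `IsManifold (𝓡 n) ∞`); no hypothesis is put on `P` (as in
  `IsConnectedSum`), consumers add `[IsManifold (𝓡 n) ∞ P]` where needed.
* Universes: the fact `connectedSum_sphere_sphere n` is stated for `M N P` in arbitrary
  universes (three universe parameters); the induction uses its `Type`-instance
  `connectedSum_sphere_sphere.{0,0,0} n`.

## References

* M. Kervaire, J. Milnor, *Groups of homotopy spheres I*, Ann. of Math. 77 (1963) 504–537, §2,
  Lemma 2.1 (p. 505). [KervaireMilnor1963]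
* R. Palais, *Extending diffeomorphisms*, Proc. Amer. Math. Soc. 11 (1960) 274–277. [Palais1960]
* A. Kosinski, *Differential Manifolds* (1993), Ch. VI §1. [Kosinski1993]
* R. S. Hamilton, *Four-manifolds with positive isotropic curvature*, Comm. Anal. Geom. 5 (1997)
  1–92, Thm. 1.1 and pp. 3–4 (the consumer). [Hamilton1997]
-/

open scoped Manifold ContDiff Topology
open Set Function

noncomputable section

namespace Literature.Topology.FourManifolds

/-- Local notation: `𝔼 n` is the model Euclidean space `EuclideanSpace ℝ (Fin n)`. -/
local notation "𝔼 " n:arg => EuclideanSpace ℝ (Fin n)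

/-- Local notation: `𝕊 n` is the unit sphere in `EuclideanSpace ℝ (Fin (n + 1))`, the standard
`n`-sphere with its Mathlib manifold structure (charts in `𝔼 n`). -/
local notation "𝕊 " n:arg => (Metric.sphere (0 : EuclideanSpace ℝ (Fin (n + 1))) 1)

universe u v w

/-! ### Transport of connected sums along diffeomorphisms of the glued manifold -/

section Transport

variable {EP HP : Type*} [NormedAddCommGroup EP] [NormedSpace ℝ EP] [TopologicalSpace HP]
  {IP : ModelWithCorners ℝ EP HP}
  {EM HM : Type*} [NormedAddCommGroup EM] [NormedSpace ℝ EM] [TopologicalSpace HM]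
  {IM : ModelWithCorners ℝ EM HM}
  {EN HN : Type*} [NormedAddCommGroup EN] [NormedSpace ℝ EN] [TopologicalSpace HN]
  {IN : ModelWithCorners ℝ EN HN}
  {M N P P' : Type*} [TopologicalSpace M] [T2Space M] [ChartedSpace HM M]
  [TopologicalSpace N] [T2Space N] [ChartedSpace HN N] [TopologicalSpace P] [ChartedSpace HP P]
  [TopologicalSpace P'] [ChartedSpace HP P'] [IsManifold IP ∞ P']

/-- **Being a connected sum is invariant under diffeomorphism of the glued manifold**: if `P` is
a connected sum `M # N` and `P ≃ₘ P'` (`P'` a `C^∞` manifold with the same model), then so is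
`P'`, along the same discs — transport the open gluing along the diffeomorphism
(`IsOpenGluing.diffeomorph_comp`, `ConnectedSumTransportProofs.lean`; Kervaire–Milnor 1963, §2;
Kosinski VI.1). [cite: KervaireMilnor1963, §2] -/
theorem IsConnectedSum.of_diffeomorph (h : IsConnectedSum IP IM IN M N P) (e : P ≃ₘ⟮IP, IP⟯ P') :
    IsConnectedSum IP IM IN M N P' := by
  obtain ⟨i₁, i₂, h₁, h₂, hG⟩ := h
  exact ⟨i₁, i₂, h₁, h₂, hG.diffeomorph_comp e rfl⟩

end Transport

/-! ### The named fact `Sⁿ # Sⁿ ≅ Sⁿ` -/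

/-- NAMED FACT (**Kervaire–Milnor 1963, Lemma 2.1**, Ann. of Math. 77, §2, p. 505: "The
connected sum operation is well defined, associative, and commutative up to orientation
preserving diffeomorphism. The sphere `Sⁿ` serves as identity element."; proof by "the lemma of
Palais [20] and Cerf [5]": any two orientation preserving embeddings `Dⁿ → M` differ by a
diffeomorphism of `M`), one `Prop` per dimension `n`. **A connected sum of two `n`-spheres is an
`n`-sphere**, `0 < n`, in the relational language of `Literature.Topology.FourManifolds.IsConnectedSum`: if the `C^∞` manifold
`P` (on `ℝⁿ`) is a connected sum `M # N`, along arbitrary smooth discs, of Hausdorff `C^∞`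
manifolds `M`, `N` both diffeomorphic to the round sphere `𝕊ⁿ`, then `P` is diffeomorphic to
`𝕊ⁿ`. This is the case `M ≅ N ≅ Sⁿ` of "well defined" + "`Sⁿ` serves as identity element"; the
orientation conditions of Kervaire–Milnor's definition can always be arranged here because `Sⁿ`
has an orientation-reversing diffeomorphism (a reflection), and "`P` is *an* open gluing along
the relation" is as good as "the" quotient by the proved uniqueness of open gluings
`Literature.Topology.FourManifolds.IsOpenGluing.nonempty_diffeomorph`. The hypothesis `0 < n` is Kervaire–Milnor's
"connected `n`-manifolds" (`S⁰` is disconnected). Discharged for every `n` by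
`Literature.Topology.FourManifolds.connectedSum_sphere_sphere_holds` (`ConnectedSumSphereIdentity.lean`, via `X # Sⁿ ≅ X`);
users take `(h : connectedSum_sphere_sphere n)` fed by that theorem; only `n = 4` is consumed
by the PIC decomposition (`PICSphereFactsProofs.lean`).
[cite: KervaireMilnor1963, §2, Lemma 2.1 (p. 505)] [cite: Palais1960, Thm. B (disc lemma, as quoted by Kervaire–Milnor 1963, p. 505)] -/
def connectedSum_sphere_sphere (n : ℕ) : Prop :=
  0 < n → ∀ (M : Type u) (N : Type v) (P : Type w)
    [TopologicalSpace M] [T2Space M] [ChartedSpace (𝔼 n) M] [IsManifold (𝓡 n) ∞ M]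
    [TopologicalSpace N] [T2Space N] [ChartedSpace (𝔼 n) N] [IsManifold (𝓡 n) ∞ N]
    [TopologicalSpace P] [ChartedSpace (𝔼 n) P] [IsManifold (𝓡 n) ∞ P],
    IsConnectedSum (𝓡 n) (𝓡 n) (𝓡 n) M N P →
    Nonempty (M ≃ₘ⟮𝓡 n, 𝓡 n⟯ 𝕊 n) → Nonempty (N ≃ₘ⟮𝓡 n, 𝓡 n⟯ 𝕊 n) →
      Nonempty (P ≃ₘ⟮𝓡 n, 𝓡 n⟯ 𝕊 n)

/-! ### Iterated connected sums of spheres -/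

/-- **`P` is a connected sum of finitely many copies of `Sⁿ`.** The smallest class of charted
spaces `P` on `ℝⁿ` (in `Type`) such that (`sphere`) every `P` diffeomorphic to the round sphere
`𝕊ⁿ` belongs to the class, and (`connectedSum`) `P` belongs to the class whenever `P` is a
connected sum `M # N` — `Literature.IsConnectedSum (𝓡 n) (𝓡 n) (𝓡 n) M N P`, Kervaire–Milnor's gluing
of `M ∖ {pt}` and `N ∖ {pt}` along punctured discs, along *arbitrary* smooth discs — of two
Hausdorff `C^∞` manifolds `M`, `N` of the class. Thus `IsConnectedSumOfSpheres n P` formalises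
"`P` is diffeomorphic to `Sⁿ` or to a connected sum `Sⁿ # ⋯ # Sⁿ` of finitely many copies of
`Sⁿ`, in some bracketing" — the shape of the conclusion of Hamilton's Main Theorem 1.1
(Comm. Anal. Geom. 5 (1997), p. 2: "diffeomorphic to `S⁴`, `RP⁴`, `S³ × S¹`, `S³ ×~ S¹`, or a
connected sum of the above") when only `S⁴` summands occur. No associativity, commutativity or
independence of choices is presupposed (these are Kervaire–Milnor 1963, Lemma 2.1); the class
is invariant under diffeomorphism (`IsConnectedSumOfSpheres.of_diffeomorph`), and by
`IsConnectedSumOfSpheres.nonempty_diffeomorph_sphere` every member is in fact diffeomorphic to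
`𝕊ⁿ` once `Sⁿ # Sⁿ ≅ Sⁿ` is granted. [folklore] -/
inductive IsConnectedSumOfSpheres (n : ℕ) :
    ∀ (P : Type) [TopologicalSpace P] [ChartedSpace (𝔼 n) P], Prop
  /-- A manifold diffeomorphic to the round sphere `𝕊ⁿ` is a connected sum of (one) sphere. -/
  | sphere {P : Type} [TopologicalSpace P] [ChartedSpace (𝔼 n) P]
      (e : P ≃ₘ⟮𝓡 n, 𝓡 n⟯ 𝕊 n) : IsConnectedSumOfSpheres n P
  /-- A connected sum `P = M # N` (relational, `Literature.Topology.FourManifolds.IsConnectedSum`) of two Hausdorff `C^∞`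
  manifolds which are connected sums of spheres is a connected sum of spheres. -/
  | connectedSum {M N P : Type} [TopologicalSpace M] [T2Space M] [ChartedSpace (𝔼 n) M]
      [IsManifold (𝓡 n) ∞ M] [TopologicalSpace N] [T2Space N] [ChartedSpace (𝔼 n) N]
      [IsManifold (𝓡 n) ∞ N] [TopologicalSpace P] [ChartedSpace (𝔼 n) P]
      (hM : IsConnectedSumOfSpheres n M) (hN : IsConnectedSumOfSpheres n N)
      (h : IsConnectedSum (𝓡 n) (𝓡 n) (𝓡 n) M N P) : IsConnectedSumOfSpheres n P

/-- The round sphere `𝕊ⁿ` itself is a connected sum of (one copy of) `𝕊ⁿ`, via the identity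
diffeomorphism. [folklore] -/
theorem IsConnectedSumOfSpheres.sphere_self (n : ℕ) : IsConnectedSumOfSpheres n (𝕊 n) :=
  .sphere (Diffeomorph.refl (𝓡 n) (𝕊 n) ∞)

/-- A manifold diffeomorphic (in either direction) to a round sphere is a connected sum of
spheres. [folklore] -/
theorem IsConnectedSumOfSpheres.of_diffeomorph_sphere {n : ℕ} {P : Type} [TopologicalSpace P]
    [ChartedSpace (𝔼 n) P] (e : (𝕊 n) ≃ₘ⟮𝓡 n, 𝓡 n⟯ P) : IsConnectedSumOfSpheres n P :=
  .sphere e.symm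

/-- **Being a connected sum of spheres is invariant under diffeomorphism** onto a `C^∞`
manifold: compose the diffeomorphism with the witness in the base case, and transport the open
gluing along it (`IsConnectedSum.of_diffeomorph`) in the inductive case. So "`P` is
diffeomorphic to a connected sum of copies of `Sⁿ`" and "`P` is a connected sum of copies of
`Sⁿ`" agree. [folklore] -/
theorem IsConnectedSumOfSpheres.of_diffeomorph {n : ℕ} {P : Type} [TopologicalSpace P]
    [ChartedSpace (𝔼 n) P] (h : IsConnectedSumOfSpheres n P) {P' : Type} [TopologicalSpace P']
    [ChartedSpace (𝔼 n) P'] [IsManifold (𝓡 n) ∞ P'] (e : P ≃ₘ⟮𝓡 n, 𝓡 n⟯ P') :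
    IsConnectedSumOfSpheres n P' := by
  cases h with
  | sphere e₀ => exact .sphere (e.symm.trans e₀)
  | connectedSum hM hN h => exact .connectedSum hM hN (h.of_diffeomorph e)

/-- Unfolding lemma: `P` is a connected sum of copies of `𝕊ⁿ` iff either `P` is diffeomorphic to
`𝕊ⁿ`, or `P` is a connected sum `M # N` of two Hausdorff `C^∞` manifolds which are connected
sums of copies of `𝕊ⁿ` (the two constructors). [folklore] -/
theorem isConnectedSumOfSpheres_iff {n : ℕ} {P : Type} [TopologicalSpace P]
    [ChartedSpace (𝔼 n) P] :
    IsConnectedSumOfSpheres n P ↔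
      Nonempty (P ≃ₘ⟮𝓡 n, 𝓡 n⟯ 𝕊 n) ∨
        ∃ (M : Type) (_ : TopologicalSpace M) (_ : T2Space M) (_ : ChartedSpace (𝔼 n) M)
          (_ : IsManifold (𝓡 n) ∞ M) (N : Type) (_ : TopologicalSpace N) (_ : T2Space N)
          (_ : ChartedSpace (𝔼 n) N) (_ : IsManifold (𝓡 n) ∞ N),
          IsConnectedSumOfSpheres n M ∧ IsConnectedSumOfSpheres n N ∧
            IsConnectedSum (𝓡 n) (𝓡 n) (𝓡 n) M N P := by
  constructor
  · intro h
    cases h with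
    | sphere e => exact Or.inl ⟨e⟩
    | @connectedSum M N _ _ _ _ _ _ _ _ _ _ _ hM hN h =>
      exact Or.inr ⟨M, ‹_›, ‹_›, ‹_›, ‹_›, N, ‹_›, ‹_›, ‹_›, ‹_›, hM, hN, h⟩
  · rintro (⟨⟨e⟩⟩ | ⟨M, _, _, _, _, N, _, _, _, _, hM, hN, h⟩)
    · exact .sphere e
    · exact .connectedSum hM hN h

/-- A connected sum of copies of `𝕊ⁿ`, `0 < n`, is nonempty (a diffeomorphic copy of `𝕊ⁿ` is
nonempty; a connected sum along discs of positive dimension is nonempty,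
`Literature.Topology.FourManifolds.IsConnectedSum.nonempty`). [folklore] -/
theorem IsConnectedSumOfSpheres.nonempty {n : ℕ} (hn : 0 < n) {P : Type} [TopologicalSpace P]
    [ChartedSpace (𝔼 n) P] (h : IsConnectedSumOfSpheres n P) : Nonempty P := by
  cases h with
  | sphere e =>
    have : Nonempty (𝕊 n) := by
      refine ⟨⟨EuclideanSpace.single 0 1, ?_⟩⟩
      simp
    exact this.map e.symm
  | connectedSum hM hN h =>
    haveI : Nontrivial (𝔼 n) := by
      haveI : Nonempty (Fin n) := ⟨⟨0, hn⟩⟩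
      infer_instance
    exact h.nonempty

/-- **A connected sum of finitely many `n`-spheres is an `n`-sphere** (`0 < n`): every member
`P` of `IsConnectedSumOfSpheres n` which is a `C^∞` manifold is diffeomorphic to the round
sphere `𝕊ⁿ`. Structural induction: the base case is its own witness, and a connected sum of two
members, both diffeomorphic to `𝕊ⁿ` by induction (the summands are `C^∞` by definition of the
class), is diffeomorphic to `𝕊ⁿ` by the named fact `connectedSum_sphere_sphere n`
(Kervaire–Milnor 1963, Lemma 2.1), taken as the hypothesis `h₂`. This is the topological half
of "Hamilton 1997, Thm. 1.1 ⇒ Cor. 1.2(a)". [cite: KervaireMilnor1963, §2, Lemma 2.1 (p. 505)] -/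
theorem IsConnectedSumOfSpheres.nonempty_diffeomorph_sphere {n : ℕ} (hn : 0 < n)
    (h₂ : connectedSum_sphere_sphere.{0, 0, 0} n) {P : Type} [TopologicalSpace P]
    [ChartedSpace (𝔼 n) P] (h : IsConnectedSumOfSpheres n P) :
    ∀ [IsManifold (𝓡 n) ∞ P], Nonempty (P ≃ₘ⟮𝓡 n, 𝓡 n⟯ 𝕊 n) := by
  induction h with
  | sphere e => intro _; exact ⟨e⟩
  | connectedSum hM hN h ihM ihN => intro _; exact h₂ hn _ _ _ h ihM ihN

end Literature.Topology.FourManifolds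

end
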